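import Mathlib
import HarnessLib
import Literature.MathematicalPhysics.QuantumLattice.FermiRG.BGM2003SectorCountingProof
import Summits.HubbardSuperconductivity.HubbardSuperconductivity.Theorems.KLProgrammeH10TwoPointLimitFrameDispersionHyp

/-!
# Route `KLProgramme` — K1/K3 (stmt-HubbardSuperconductivity-19938 / 20437), risk-register item 2:
# BGM 2003's SECTOR COUNTING LEMMA 3.1 (the `(L−3)` relative count, momentum conservation in `ℝ²`) and the sector lemmata 7.3 / 7.5
# ON THE CURVE OF EVERY FRAME of small `C²` size and of every admissible frame in the KL regime

Cell gate-hubbard-kl, seat p4 (C5a), g11.  Composition of t3's PROVED general-dispersion theorems (`FermiRG/BGM2003Sectors.lean`: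
`lemma73_sectorBox_holds`, `lemma75_parallelogram_holds`; `FermiRG/BGM2003SectorCountingProof.lean`: `lemma31_sectorCounting_holds`) with this
lineage's `dispersionHyp_frame` / `dispersionHyp_frameOK` (`…FrameDispersionHyp`): Benfatto–Giuliani–Mastropietro 2003 Lemma 3.1 (4.3) — for every
fixed fine sector `ω₁` and coarse sectors `ω̃₂, …, ω̃_L` the number of fine sector strings refining them and admitting momenta with `Σ k⃗ᵢ = 0` IN `ℝ²`
is `≤ c^L 2^{(n′−n)(L−3)}` (`L ≥ 4`), `≤ c` (`L = 2`) — holds for the s-sectors cut from the curve `{ε₀ + δ_K = μ + e}` of every frame `K` with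
`4A ≤ κ(window)`, in particular of every frame admissible in the KL regime; the constant `c` is the one t3's proof produces from the frame's
`DispersionHyp` datum (uniformity of `c` along a FAMILY of frames is NOT asserted here — that is the wave's gap G-002 / E1-TOWER-BLOCKED §5, and the
torus (`2πℤ²`, umklapp-corner) part of the `(L−3)` count is the separate COUNTING-NOTE-2 item):

* `frame_bgm2003_sectorCounting`, `frame_bgm2003_sectorCounting_four` (`L = 4`: `≤ c⁴·2^{n′−n}`), `frameOK_bgm2003_sectorCounting`;
* `frame_bgm2003_lemma73` (sector box), `frame_bgm2003_lemma75` (parallelogram lemma) — the geometric inputs of the `2πG ≠ 0` analysis to come.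

Everything is PROVED by composition; no definitions, no named facts.  References: BGM 2003 §3.1 Lemma 3.1 (4.3), §7.1 Lemma 7.3, §7.3 Lemma 7.5, §7.4
[cite: BenfattoGiulianiMastropietro2003]; BGM 2006 App. A3 Lemma A3.1 [cite: BenfattoGiulianiMastropietro2006].
-/

noncomputable section

namespace Summit.HubbardSuperconductivity.HubbardSuperconductivity.Theorems.PerturbedFermiCurve

set_option linter.dupNamespace false -- summit = problem name (single-conjunct summit), D-0017

open Real Set
open Literature.MathematicalPhysics.QuantumLattice Literature.MathematicalPhysics.QuantumLattice.BandSectorCounting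
open Literature.MathematicalPhysics.QuantumLattice.FermiRG Literature.MathematicalPhysics.QuantumLattice.FermiRG.BGM2003
open Summit.HubbardSuperconductivity.HubbardSuperconductivity.Theorems.DispersionFlow
open Summit.HubbardSuperconductivity.HubbardSuperconductivity.Theorems.KLRegimeSplit

/-- **BGM 2003 Lemma 3.1 (4.3) on the curve of every frame of small `C²` size**: for every level window `[μ₁, μ₂] ⊂ (-4, 0)` there are `e₀, κ > 0`
such that for every frame `K` with `C²` size `A`, `4A ≤ κ`, and every `μ ∈ [μ₁, μ₂]` there is `c > 0` with: for all `n ≤ n′`, the number of scale-`n′`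
s-sector strings of the curve `{ε₀ + δ_K = μ + e}` refining given scale-`n` sectors (first entry fixed) compatible with `Σ k⃗ᵢ = 0` in `ℝ²` is
`≤ c^L 2^{(n′−n)(L−3)}` for `L ≥ 4` and `≤ c` for `L = 2`. [cite: BenfattoGiulianiMastropietro2003, §3.1 Lemma 3.1 (4.3) and §7.4] -/
theorem frame_bgm2003_sectorCounting :
    ∀ μ₁ μ₂ : ℝ, -4 < μ₁ → μ₁ ≤ μ₂ → μ₂ < 0 → ∃ e₀ : ℝ, 0 < e₀ ∧ ∃ κ : ℝ, 0 < κ ∧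
      ∀ (K : TrigPolyC4v) (A : ℝ), (∀ p : Momentum, ∀ j ≤ 2, ‖iteratedFDeriv ℝ j (frameShift K) p‖ ≤ A) → 4 * A ≤ κ →
      ∀ μ ∈ Set.Icc μ₁ μ₂, ∃ c : ℝ, 0 < c ∧ ∀ (n n' : ℕ), n ≤ n' →
        (∀ (L : ℕ) (i₁ : Fin L) (ω₁ : ℕ) (ωt : Fin L → ℕ), 4 ≤ L → ω₁ < sectorCount n' → (∀ i, ωt i < sectorCount n) →
          (Nat.card (sectorStrings (fun ϑ e => perturbedFermiRadius (fun k : Fin 2 → ℝ => frameShift K (WithLp.toLp 2 k)) (μ + e) ϑ)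
            e₀ n n' L i₁ ω₁ ωt) : ℝ) ≤ c ^ L * (2 : ℝ) ^ ((n' - n) * (L - 3))) ∧
        (∀ (i₁ : Fin 2) (ω₁ : ℕ) (ωt : Fin 2 → ℕ), ω₁ < sectorCount n' → (∀ i, ωt i < sectorCount n) →
          (Nat.card (sectorStrings (fun ϑ e => perturbedFermiRadius (fun k : Fin 2 → ℝ => frameShift K (WithLp.toLp 2 k)) (μ + e) ϑ)
            e₀ n n' 2 i₁ ω₁ ωt) : ℝ) ≤ c) := by
  intro μ₁ μ₂ hμ₁ h12 hμ₂
  obtain ⟨e₀, he₀, κ, hκ, h⟩ := dispersionHyp_frame μ₁ μ₂ hμ₁ h12 hμ₂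
  refine ⟨e₀, he₀, κ, hκ, fun K A hA hAκ μ hμ => ?_⟩
  exact lemma31_sectorCounting_holds _ _ _ _ (h K A hA hAκ μ hμ)

/-- **The four-leg case** on frames: `≤ c⁴·2^{n′−n}` fine refinements (`γ^{(h−h′)/2}`, no `|h|`). [cite: BenfattoGiulianiMastropietro2003, §3.1 Lemma 3.1 (4.3)] -/
theorem frame_bgm2003_sectorCounting_four :
    ∀ μ₁ μ₂ : ℝ, -4 < μ₁ → μ₁ ≤ μ₂ → μ₂ < 0 → ∃ e₀ : ℝ, 0 < e₀ ∧ ∃ κ : ℝ, 0 < κ ∧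
      ∀ (K : TrigPolyC4v) (A : ℝ), (∀ p : Momentum, ∀ j ≤ 2, ‖iteratedFDeriv ℝ j (frameShift K) p‖ ≤ A) → 4 * A ≤ κ →
      ∀ μ ∈ Set.Icc μ₁ μ₂, ∃ c : ℝ, 0 < c ∧ ∀ (n n' : ℕ), n ≤ n' →
        ∀ (i₁ : Fin 4) (ω₁ : ℕ) (ωt : Fin 4 → ℕ), ω₁ < sectorCount n' → (∀ i, ωt i < sectorCount n) →
          (Nat.card (sectorStrings (fun ϑ e => perturbedFermiRadius (fun k : Fin 2 → ℝ => frameShift K (WithLp.toLp 2 k)) (μ + e) ϑ)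
            e₀ n n' 4 i₁ ω₁ ωt) : ℝ) ≤ c ^ 4 * (2 : ℝ) ^ (n' - n) := by
  intro μ₁ μ₂ hμ₁ h12 hμ₂
  obtain ⟨e₀, he₀, κ, hκ, h⟩ := frame_bgm2003_sectorCounting μ₁ μ₂ hμ₁ h12 hμ₂
  refine ⟨e₀, he₀, κ, hκ, fun K A hA hAκ μ hμ => ?_⟩
  obtain ⟨c, hc, hcount⟩ := h K A hA hAκ μ hμ
  refine ⟨c, hc, fun n n' hnn' i₁ ω₁ ωt hω₁ hωt => ?_⟩
  have h4 := (hcount n n' hnn').1 4 i₁ ω₁ ωt le_rfl hω₁ hωt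
  simpa using h4

/-- **BGM 2003 Lemma 3.1 (4.3) ON EVERY ADMISSIBLE FRAME IN THE KL REGIME.** [cite: BenfattoGiulianiMastropietro2003, §3.1 Lemma 3.1 (4.3) and §7.4] -/
theorem frameOK_bgm2003_sectorCounting :
    ∀ μ₁ μ₂ : ℝ, -4 < μ₁ → μ₁ ≤ μ₂ → μ₂ < 0 → ∃ e₀ : ℝ, 0 < e₀ ∧ ∀ R : RenConsts, (∀ j, 0 ≤ R.Gfr j) →
      ∃ c₃ : ℝ, 0 < c₃ ∧ ∃ U₀ : ℝ, 0 < U₀ ∧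
      ∀ c : ℝ, 0 < c → c ≤ c₃ → ∀ U : ℝ, 0 < U → U ≤ U₀ → ∀ β : ℝ, klBetaMin ≤ β → β ≤ Real.exp (c / U ^ 2) →
      ∀ μ ∈ Set.Icc μ₁ μ₂, ∀ (ν : ℝ) (K : TrigPolyC4v), FrameOK R U (nScales β) ν K →
      ∃ c' : ℝ, 0 < c' ∧ ∀ (n n' : ℕ), n ≤ n' →
        (∀ (L : ℕ) (i₁ : Fin L) (ω₁ : ℕ) (ωt : Fin L → ℕ), 4 ≤ L → ω₁ < sectorCount n' → (∀ i, ωt i < sectorCount n) →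
          (Nat.card (sectorStrings (fun ϑ e => perturbedFermiRadius (fun k : Fin 2 → ℝ => frameShift K (WithLp.toLp 2 k)) (μ + e) ϑ)
            e₀ n n' L i₁ ω₁ ωt) : ℝ) ≤ c' ^ L * (2 : ℝ) ^ ((n' - n) * (L - 3))) ∧
        (∀ (i₁ : Fin 2) (ω₁ : ℕ) (ωt : Fin 2 → ℕ), ω₁ < sectorCount n' → (∀ i, ωt i < sectorCount n) →
          (Nat.card (sectorStrings (fun ϑ e => perturbedFermiRadius (fun k : Fin 2 → ℝ => frameShift K (WithLp.toLp 2 k)) (μ + e) ϑ)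
            e₀ n n' 2 i₁ ω₁ ωt) : ℝ) ≤ c') := by
  intro μ₁ μ₂ hμ₁ h12 hμ₂
  obtain ⟨e₀, he₀, h⟩ := dispersionHyp_frameOK μ₁ μ₂ hμ₁ h12 hμ₂
  refine ⟨e₀, he₀, fun R hR => ?_⟩
  obtain ⟨c₃, hc₃, U₀, hU₀, hreg⟩ := h R hR
  refine ⟨c₃, hc₃, U₀, hU₀, ?_⟩
  intro c hc hcle U hU hUle β hβmin hβc μ hμ ν K hK
  exact lemma31_sectorCounting_holds _ _ _ _ (hreg c hc hcle U hU hUle β hβmin hβc μ hμ ν K hK)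

/-- **BGM 2003 Lemma 7.3 (the sector box and the tangential derivative bound) on the curve of every frame of small `C²` size.**
[cite: BenfattoGiulianiMastropietro2003, §7.1 Lemma 7.3 (A1.13)–(A1.14)] -/
theorem frame_bgm2003_lemma73 :
    ∀ μ₁ μ₂ : ℝ, -4 < μ₁ → μ₁ ≤ μ₂ → μ₂ < 0 → ∃ e₀ : ℝ, 0 < e₀ ∧ ∃ κ : ℝ, 0 < κ ∧
      ∀ (K : TrigPolyC4v) (A : ℝ), (∀ p : Momentum, ∀ j ≤ 2, ‖iteratedFDeriv ℝ j (frameShift K) p‖ ≤ A) → 4 * A ≤ κ →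
      ∀ μ ∈ Set.Icc μ₁ μ₂, ∃ c : ℝ, 0 < c ∧ ∀ (n ω : ℕ), ω < sectorCount n →
        ∀ p ∈ sSector (fun ϑ e => perturbedFermiRadius (fun k : Fin 2 → ℝ => frameShift K (WithLp.toLp 2 k)) (μ + e) ϑ) e₀ n ω,
        ∃ k₁ k₂ : ℝ,
          p = fermiPoint (fun ϑ e => perturbedFermiRadius (fun k : Fin 2 → ℝ => frameShift K (WithLp.toLp 2 k)) (μ + e) ϑ) (sectorCenter n ω) +
                k₁ • unitNormal (fun ϑ e => perturbedFermiRadius (fun k : Fin 2 → ℝ => frameShift K (WithLp.toLp 2 k)) (μ + e) ϑ)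
                  (sectorCenter n ω) 0 +
                k₂ • unitTangent (fun ϑ e => perturbedFermiRadius (fun k : Fin 2 → ℝ => frameShift K (WithLp.toLp 2 k)) (μ + e) ϑ)
                  (sectorCenter n ω) 0 ∧
          |k₁| ≤ c * (4 : ℝ) ^ (-(n : ℤ)) ∧ |k₂| ≤ c * (2 : ℝ) ^ (-(n : ℤ)) ∧
          |fderiv ℝ (fun k => sqDispersion k + frameShift K (WithLp.toLp 2 k)) p
              (unitTangent (fun ϑ e => perturbedFermiRadius (fun k : Fin 2 → ℝ => frameShift K (WithLp.toLp 2 k)) (μ + e) ϑ)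
                (sectorCenter n ω) 0)| ≤ c * (2 : ℝ) ^ (-(n : ℤ)) := by
  intro μ₁ μ₂ hμ₁ h12 hμ₂
  obtain ⟨e₀, he₀, κ, hκ, h⟩ := dispersionHyp_frame μ₁ μ₂ hμ₁ h12 hμ₂
  refine ⟨e₀, he₀, κ, hκ, fun K A hA hAκ μ hμ => ?_⟩
  exact lemma73_sectorBox_holds _ _ _ _ (h K A hA hAκ μ hμ)

/-- **BGM 2003 Lemma 7.5 (the parallelogram lemma) on the curve of every frame of small `C²` size.**
[cite: BenfattoGiulianiMastropietro2003, §7.3 Lemma 7.5 (s1.16)–(s1.18)] -/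
theorem frame_bgm2003_lemma75 :
    ∀ μ₁ μ₂ : ℝ, -4 < μ₁ → μ₁ ≤ μ₂ → μ₂ < 0 → ∃ e₀ : ℝ, 0 < e₀ ∧ ∃ κ : ℝ, 0 < κ ∧
      ∀ (K : TrigPolyC4v) (A : ℝ), (∀ p : Momentum, ∀ j ≤ 2, ‖iteratedFDeriv ℝ j (frameShift K) p‖ ≤ A) → 4 * A ≤ κ →
      ∀ μ ∈ Set.Icc μ₁ μ₂, ∀ c₁ : ℝ, 0 < c₁ → ∃ c₀ c₂ η₀ : ℝ, 0 < c₀ ∧ 0 < c₂ ∧ 0 < η₀ ∧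
        ∀ θ₁' θ₂' η r₁ r₂ : ℝ, (θ₁', θ₂') ∈ pairChartDomain →
          |r₁| ≤ c₁ * η * pairAngle θ₁' θ₂' → |r₂| ≤ η → η ≤ c₂ * pairAngle θ₁' θ₂' → η ≤ η₀ →
            fermiPoint (fun ϑ e => perturbedFermiRadius (fun k : Fin 2 → ℝ => frameShift K (WithLp.toLp 2 k)) (μ + e) ϑ) θ₁' +
                fermiPoint (fun ϑ e => perturbedFermiRadius (fun k : Fin 2 → ℝ => frameShift K (WithLp.toLp 2 k)) (μ + e) ϑ) θ₂' +
                (r₁ • unitNormal (fun ϑ e => perturbedFermiRadius (fun k : Fin 2 → ℝ => frameShift K (WithLp.toLp 2 k)) (μ + e) ϑ) θ₁' 0 +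
                  r₂ • unitTangent (fun ϑ e => perturbedFermiRadius (fun k : Fin 2 → ℝ => frameShift K (WithLp.toLp 2 k)) (μ + e) ϑ) θ₁' 0)
              ∈ pairRange (fun ϑ e => perturbedFermiRadius (fun k : Fin 2 → ℝ => frameShift K (WithLp.toLp 2 k)) (μ + e) ϑ) ∧
            ∃ θ₁ θ₂ : ℝ,
              fermiPoint (fun ϑ e => perturbedFermiRadius (fun k : Fin 2 → ℝ => frameShift K (WithLp.toLp 2 k)) (μ + e) ϑ) θ₁' +
                  fermiPoint (fun ϑ e => perturbedFermiRadius (fun k : Fin 2 → ℝ => frameShift K (WithLp.toLp 2 k)) (μ + e) ϑ) θ₂' +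
                  (r₁ • unitNormal (fun ϑ e => perturbedFermiRadius (fun k : Fin 2 → ℝ => frameShift K (WithLp.toLp 2 k)) (μ + e) ϑ) θ₁' 0 +
                    r₂ • unitTangent (fun ϑ e => perturbedFermiRadius (fun k : Fin 2 → ℝ => frameShift K (WithLp.toLp 2 k)) (μ + e) ϑ) θ₁' 0) =
                fermiPoint (fun ϑ e => perturbedFermiRadius (fun k : Fin 2 → ℝ => frameShift K (WithLp.toLp 2 k)) (μ + e) ϑ) θ₁ +
                  fermiPoint (fun ϑ e => perturbedFermiRadius (fun k : Fin 2 → ℝ => frameShift K (WithLp.toLp 2 k)) (μ + e) ϑ) θ₂ ∧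
              |θ₁ - θ₁'| ≤ c₀ * η ∧ |θ₂ - θ₂'| ≤ c₀ * η := by
  intro μ₁ μ₂ hμ₁ h12 hμ₂
  obtain ⟨e₀, he₀, κ, hκ, h⟩ := dispersionHyp_frame μ₁ μ₂ hμ₁ h12 hμ₂
  refine ⟨e₀, he₀, κ, hκ, fun K A hA hAκ μ hμ => ?_⟩
  exact lemma75_parallelogram_holds _ _ _ _ (h K A hA hAκ μ hμ)

end Summit.HubbardSuperconductivity.HubbardSuperconductivity.Theorems.PerturbedFermiCurve

end
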